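import Summits.QuantumFields.QCD.Theorems.PauliWegnerSeaFMClosureUnquenchedTwoStarC1

/-!
# Crux `GaussianLinkFrames.FrameFMClosure` (stmt-QuantumFields-17375), line `pad-the-fibre`, stub
`stub_twoStarOfPadded` — helper 2: ASFH Lemma 6 (the depleted-factor decoupling, fibre form of clause (Tdec)) on an
ARBITRARY refit fibre with the cofactor domination supplied PER FIBRE

Region-generic re-run of `VonMisesCirclesC1.fibre_Tdec` (`…TwoStarC1Aux6`): the band law is taken at an arbitrary link
budget `n` (hypothesis `hB`, the body of `FibreBandLaw n (4 N_f + 4)` verbatim) and the domination of the `(a,b)` adjugate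
block of `D_A ⊕ 1` by `C₀ · sup_fibre |det (D_A ⊕ 1)|` is a hypothesis about the ONE fibre at hand (`hdom`); nothing else of
K1♭ is used, so the lemma serves the padded domination of this line (regions = stars ∪ canonical pad regions) and any
later variant.  The (c,d) factor `‖D⁻¹(c,d)‖₁^s` needs no domination (largest adjugate entry + (Flat) + (AE)).

References: Aizenman–Schenker–Friedrich–Hundertmark, CMP 224 (2001) 219, Lemma 6, App. A [AizenmanEtAl2001].
-/

noncomputable section

open scoped BigOperators ENNReal
open MeasureTheory
open Literature.MathematicalPhysics.QuantumFieldTheory Literature.MathematicalPhysics.QuantumLattice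
  Literature.Probability.LatticeModels
open Summit.QuantumFields.QCD.Theorems.VonMisesCircles Summit.QuantumFields.QCD.Theorems.VonMisesCirclesC1

namespace Summit.QuantumFields.QCD.Theorems.PadTheFibreTwoStar

section Generic

variable {Nf n : ℕ} {s₁ C₁ p₁ C₀ m₀ : ℝ}

variable (hB : ∀ (N : ℕ) [NeZero N] (R : Finset (Edge 4 N)), R.card ≤ n →
    ∀ (U : GaugeConfig 4 N (Matrix.specialUnitaryGroup (Fin 3) ℂ)) (β : ℝ)
      (P Q : GaugeConfig 4 N (Matrix.specialUnitaryGroup (Fin 3) ℂ) → ℂ),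
      IsFibrePoly (4 * Nf + 4) P → IsFibrePoly (4 * Nf + 4) Q →
      let refit : GaugeConfig 4 N (Matrix.specialUnitaryGroup (Fin 3) ℂ) →
          GaugeConfig 4 N (Matrix.specialUnitaryGroup (Fin 3) ℂ) := fun W e => if e ∈ R then W e else U e
      let wt : GaugeConfig 4 N (Matrix.specialUnitaryGroup (Fin 3) ℂ) → ℝ := fun W =>
        Real.exp (-(β * wilsonAction (fundamentalRep (Fin 3)) (refit W))) * ‖P (refit W)‖
      let haar : Measure (GaugeConfig 4 N (Matrix.specialUnitaryGroup (Fin 3) ℂ)) :=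
        Measure.pi fun _ => haarProbability (Matrix.specialUnitaryGroup (Fin 3) ℂ)
      let Z : ℝ := ∫ W, wt W ∂haar
      (∃ W, P (refit W) ≠ 0) →
        ((∃ W, Q (refit W) ≠ 0) → ∀ᵐ W ∂haar, Q (refit W) ≠ 0) ∧
        (∀ W₀ : GaugeConfig 4 N (Matrix.specialUnitaryGroup (Fin 3) ℂ),
          ‖Q (refit W₀)‖ ≤ C₁ * (1 + |β|) ^ p₁ * ((∫ W, ‖Q (refit W)‖ * wt W ∂haar) / Z)) ∧
        (∀ s : ℝ, 0 < s → s ≤ s₁ →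
          Integrable (fun W => ‖Q (refit W)‖ ^ (-s) * wt W) haar ∧
          (∫ W, ‖Q (refit W)‖ ^ (-s) * wt W ∂haar) / Z ≤
            C₁ * (1 + |β|) ^ p₁ *
              (⨆ W : GaugeConfig 4 N (Matrix.specialUnitaryGroup (Fin 3) ℂ), ‖Q (refit W)‖) ^ (-s)))
  (hC₁ : 0 < C₁) (hC₀ : 0 < C₀)

include hB hC₁ hC₀

/-- **ASFH Lemma 6 on a dominated fibre (fibre form of (Tdec)).**  For ANY side `A`, sites `a b c d`, free links `R`
(`#R ≤ n`), outside field `U`, `0 < s ≤ 1`, `2s ≤ s₁`: if the `(a,b)` adjugate block of `D_A ⊕ 1` is dominated by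
`C₀ · sup_fibre |det (D_A ⊕ 1)|` along the fibre, then with `wt = e^{-βS}|det 𝔇|`
`∫ wt ‖G_A(a,b)‖₁^s ‖D⁻¹(c,d)‖₁^s ≤ C₀^s 144^s (C₁(1+|β|)^{p₁})² ∫ wt ‖D⁻¹(c,d)‖₁^s` over the fibre (AM–GM with the parameter
`σ^s M_D^{-s} M_A^s`, (Neg) twice, (AE) + (Flat) for the reverse inequality; verbatim the proof of
`VonMisesCirclesC1.fibre_Tdec` with the domination read from `hdom`). [cite: AizenmanEtAl2001, Lemma 6] -/
theorem fibre_Tdec_of_dom {S : ℕ} (β : ℝ) (mq : Fin Nf → ℝ) (A : Finset (TorusSite 4 (2 * S + 1)))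
    (a b c d : TorusSite 4 (2 * S + 1))
    (R : Finset (Edge 4 (2 * S + 1))) (hRcard : R.card ≤ n)
    (s : ℝ) (hs : 0 < s) (hs1 : s ≤ 1) (hs2 : 2 * s ≤ s₁)
    (U : GaugeConfig 4 (2 * S + 1) (Matrix.specialUnitaryGroup (Fin 3) ℂ))
    (hdom : ∀ W : GaugeConfig 4 (2 * S + 1) (Matrix.specialUnitaryGroup (Fin 3) ℂ),
      blockNorm ((sideMatrix A (wilsonD (fun e => if e ∈ R then W e else U e) m₀)).adjugate) a b ≤
        C₀ * ⨆ W' : GaugeConfig 4 (2 * S + 1) (Matrix.specialUnitaryGroup (Fin 3) ℂ),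
          ‖(sideMatrix A (wilsonD (fun e => if e ∈ R then W' e else U e) m₀)).det‖) :
    ∫⁻ W, ENNReal.ofReal (Real.exp (-(β * wilsonAction (fundamentalRep (Fin 3))
          (fun e => if e ∈ R then W e else U e))) *
        ‖(diracMatrix (fun e => if e ∈ R then W e else U e) mq).det‖ *
        (blockNorm (gside A (wilsonD (fun e => if e ∈ R then W e else U e) m₀)) a b ^ s *
          blockNorm (wilsonD (fun e => if e ∈ R then W e else U e) m₀)⁻¹ c d ^ s))
      ∂(Measure.pi fun _ : Edge 4 (2 * S + 1) => haarProbability (Matrix.specialUnitaryGroup (Fin 3) ℂ)) ≤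
    ENNReal.ofReal (C₀ ^ s * (144 : ℝ) ^ s * (C₁ * (1 + |β|) ^ p₁) ^ 2) *
      ∫⁻ W, ENNReal.ofReal (Real.exp (-(β * wilsonAction (fundamentalRep (Fin 3))
          (fun e => if e ∈ R then W e else U e))) *
        ‖(diracMatrix (fun e => if e ∈ R then W e else U e) mq).det‖ *
        blockNorm (wilsonD (fun e => if e ∈ R then W e else U e) m₀)⁻¹ c d ^ s)
      ∂(Measure.pi fun _ : Edge 4 (2 * S + 1) => haarProbability (Matrix.specialUnitaryGroup (Fin 3) ℂ)) := by
  -- abbreviations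
  let T : GaugeConfig 4 (2 * S + 1) (Matrix.specialUnitaryGroup (Fin 3) ℂ) →
      GaugeConfig 4 (2 * S + 1) (Matrix.specialUnitaryGroup (Fin 3) ℂ) := fun W e => if e ∈ R then W e else U e
  let haar : Measure (GaugeConfig 4 (2 * S + 1) (Matrix.specialUnitaryGroup (Fin 3) ℂ)) :=
    Measure.pi fun _ => haarProbability (Matrix.specialUnitaryGroup (Fin 3) ℂ)
  let P : GaugeConfig 4 (2 * S + 1) (Matrix.specialUnitaryGroup (Fin 3) ℂ) → ℂ := fun V => (diracMatrix V mq).det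
  let QA : GaugeConfig 4 (2 * S + 1) (Matrix.specialUnitaryGroup (Fin 3) ℂ) → ℂ := fun V =>
    (sideMatrix A (wilsonD V m₀)).det
  let QD : GaugeConfig 4 (2 * S + 1) (Matrix.specialUnitaryGroup (Fin 3) ℂ) → ℂ := fun V =>
    (wilsonD V m₀).det
  let ent : Fin 3 × Fin 4 × Fin 3 × Fin 4 → GaugeConfig 4 (2 * S + 1) (Matrix.specialUnitaryGroup (Fin 3) ℂ) → ℂ :=
    fun κ V => (wilsonD V m₀).adjugate (c, κ.1, κ.2.1) (d, κ.2.2.1, κ.2.2.2)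
  let wt : GaugeConfig 4 (2 * S + 1) (Matrix.specialUnitaryGroup (Fin 3) ℂ) → ℝ := fun W =>
    Real.exp (-(β * wilsonAction (fundamentalRep (Fin 3)) (T W))) * ‖P (T W)‖
  have hwtdef : wt = fun W => Real.exp (-(β * wilsonAction (fundamentalRep (Fin 3)) (T W))) * ‖P (T W)‖ := rfl
  let Cβ : ℝ := C₁ * (1 + |β|) ^ p₁
  have hCβ0 : 0 ≤ Cβ := mul_nonneg hC₁.le (Real.rpow_nonneg (by positivity) _)
  have hTm : Measurable T := measurable_refit R U
  have hTc : Continuous T := continuous_refit R U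
  have hP : IsFibrePoly (4 * Nf + 4) P := fibrePoly_mono (isFibrePoly_det_diracMatrix mq) (by omega)
  have hQA : IsFibrePoly (4 * Nf + 4) QA := fibrePoly_mono (isFibrePoly_sideDet A m₀) (by omega)
  have hQD : IsFibrePoly (4 * Nf + 4) QD := fibrePoly_mono (isFibrePoly_det_wilsonD m₀) (by omega)
  have hent : ∀ κ, IsFibrePoly (4 * Nf + 4) (ent κ) := fun κ =>
    fibrePoly_mono (isFibrePoly_adj_wilsonD m₀ _ _) (by omega)
  have hwt0 : ∀ W, 0 ≤ wt W := fun W => mul_nonneg (Real.exp_pos _).le (norm_nonneg _)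
  have hwti : Integrable wt haar := integrable_weight_refit β mq R U
  have hSm := measurable_wilsonAction (d := 4) (L := 2 * S + 1) (fundamentalRep (Fin 3))
    (continuous_fundamentalRep (Fin 3))
  have hwtm : Measurable wt :=
    (Real.measurable_exp.comp ((hSm.comp hTm).const_mul β).neg).mul (hP.1.measurable.comp hTm).norm
  -- notation for the two factors on the fibre
  let X : GaugeConfig 4 (2 * S + 1) (Matrix.specialUnitaryGroup (Fin 3) ℂ) → ℝ := fun W =>
    blockNorm (gside A (wilsonD (T W) m₀)) a b ^ s
  have hXdef : X = fun W => blockNorm (gside A (wilsonD (T W) m₀)) a b ^ s := rfl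
  let Y : GaugeConfig 4 (2 * S + 1) (Matrix.specialUnitaryGroup (Fin 3) ℂ) → ℝ := fun W =>
    blockNorm (wilsonD (T W) m₀)⁻¹ c d ^ s
  have hYdef : Y = fun W => blockNorm (wilsonD (T W) m₀)⁻¹ c d ^ s := rfl
  have hX0 : ∀ W, 0 ≤ X W := fun W => Real.rpow_nonneg (blockNorm_nonneg _ _ _) _
  have hY0 : ∀ W, 0 ≤ Y W := fun W => Real.rpow_nonneg (blockNorm_nonneg _ _ _) _
  change ∫⁻ W, ENNReal.ofReal (wt W * (X W * Y W)) ∂haar ≤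
    ENNReal.ofReal (C₀ ^ s * (144 : ℝ) ^ s * Cβ ^ 2) * ∫⁻ W, ENNReal.ofReal (wt W * Y W) ∂haar
  -- a vanishing integrand makes the claim trivial
  have triv : (∀ W, wt W * (X W * Y W) = 0) →
      ∫⁻ W, ENNReal.ofReal (wt W * (X W * Y W)) ∂haar ≤
        ENNReal.ofReal (C₀ ^ s * (144 : ℝ) ^ s * Cβ ^ 2) * ∫⁻ W, ENNReal.ofReal (wt W * Y W) ∂haar := by
    intro h0
    calc ∫⁻ W, ENNReal.ofReal (wt W * (X W * Y W)) ∂haar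
        = ∫⁻ _W, 0 ∂haar := lintegral_congr fun W => by rw [h0 W, ENNReal.ofReal_zero]
      _ ≤ _ := by rw [lintegral_zero]; exact bot_le
  -- degenerate fibre: the tilt vanishes identically
  by_cases hPex : ∃ W, P (T W) ≠ 0
  swap
  · push Not at hPex
    exact triv fun W => by rw [hwtdef]; simp [hPex W]
  -- suprema over the fibre
  have hQAc : Continuous fun W => ‖QA (T W)‖ := (hQA.1.comp hTc).norm
  have hQDc : Continuous fun W => ‖QD (T W)‖ := (hQD.1.comp hTc).norm
  have hentc : ∀ κ, Continuous fun W => ‖ent κ (T W)‖ := fun κ => ((hent κ).1.comp hTc).norm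
  have hbddA : BddAbove (Set.range fun W => ‖QA (T W)‖) := (isCompact_range hQAc).bddAbove
  have hbddD : BddAbove (Set.range fun W => ‖QD (T W)‖) := (isCompact_range hQDc).bddAbove
  have hbdde : ∀ κ, BddAbove (Set.range fun W => ‖ent κ (T W)‖) := fun κ => (isCompact_range (hentc κ)).bddAbove
  obtain ⟨MA, hMAdef⟩ : ∃ M : ℝ, M = ⨆ W, ‖QA (T W)‖ := ⟨_, rfl⟩
  obtain ⟨MD, hMDdef⟩ : ∃ M : ℝ, M = ⨆ W, ‖QD (T W)‖ := ⟨_, rfl⟩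
  obtain ⟨σκ, hσκdef⟩ : ∃ f : Fin 3 × Fin 4 × Fin 3 × Fin 4 → ℝ, f = fun κ => ⨆ W, ‖ent κ (T W)‖ := ⟨_, rfl⟩
  have hMA0 : 0 ≤ MA := by rw [hMAdef]; exact Real.iSup_nonneg fun W => norm_nonneg _
  have hMD0 : 0 ≤ MD := by rw [hMDdef]; exact Real.iSup_nonneg fun W => norm_nonneg _
  have hσκ0 : ∀ κ, 0 ≤ σκ κ := fun κ => by rw [hσκdef]; exact Real.iSup_nonneg fun W => norm_nonneg _
  have hleMA : ∀ W, ‖QA (T W)‖ ≤ MA := fun W => by rw [hMAdef]; exact le_ciSup hbddA W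
  have hleMD : ∀ W, ‖QD (T W)‖ ≤ MD := fun W => by rw [hMDdef]; exact le_ciSup hbddD W
  have hleσκ : ∀ κ W, ‖ent κ (T W)‖ ≤ σκ κ := fun κ W => by rw [hσκdef]; exact le_ciSup (hbdde κ) W
  -- the largest adjugate entry of the `(c, d)` block
  obtain ⟨κs, -, hκs⟩ := Finset.exists_max_image Finset.univ σκ Finset.univ_nonempty
  have hκs' : ∀ κ, σκ κ ≤ σκ κs := fun κ => hκs κ (Finset.mem_univ κ)
  obtain ⟨σs, hσsdef⟩ : ∃ t : ℝ, t = σκ κs := ⟨_, rfl⟩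
  have hσs0 : 0 ≤ σs := hσsdef ▸ hσκ0 κs
  -- the adjugate block norm on the fibre is bounded by `144 σs`
  have hadjD : ∀ W, blockNorm (wilsonD (T W) m₀).adjugate c d ≤ 144 * σs := fun W =>
    blockNorm_le_of_forall_le _ c d σs fun a' b' i j => (hleσκ (a', i, b', j) W).trans (hσsdef ▸ hκs' _)
  -- degenerate cases `MA = 0`, `MD = 0`, `σs = 0`
  rcases hMA0.lt_or_eq with hMApos | hMA0'
  swap
  · refine triv fun W => ?_
    have hdet : (sideMatrix A (wilsonD (T W) m₀)).det = 0 :=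
      norm_eq_zero.1 (le_antisymm (hMA0' ▸ hleMA W) (norm_nonneg _))
    simp only [hXdef]
    rw [gside, blockNorm_inv_of_det_eq_zero _ _ _ hdet, Real.zero_rpow hs.ne']; ring
  rcases hMD0.lt_or_eq with hMDpos | hMD0'
  swap
  · refine triv fun W => ?_
    have hdet : (wilsonD (T W) m₀).det = 0 := norm_eq_zero.1 (le_antisymm (hMD0' ▸ hleMD W) (norm_nonneg _))
    simp only [hYdef]
    rw [blockNorm_inv_of_det_eq_zero _ _ _ hdet, Real.zero_rpow hs.ne']; ring
  rcases hσs0.lt_or_eq with hσspos | hσs0'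
  swap
  · refine triv fun W => ?_
    have hadj0 : blockNorm (wilsonD (T W) m₀).adjugate c d = 0 :=
      le_antisymm (by simpa [← hσs0'] using hadjD W) (blockNorm_nonneg _ _ _)
    simp only [hYdef]
    rw [blockNorm_inv, hadj0, mul_zero, Real.zero_rpow hs.ne']; ring
  -- the band law on this fibre
  have hfib := hB (2 * S + 1) R hRcard U β P
  -- (Neg) at `2s` for `QA` and `QD`
  have hNegA : Integrable (fun W => ‖QA (T W)‖ ^ (-(2 * s)) * wt W) haar ∧
      (∫ W, ‖QA (T W)‖ ^ (-(2 * s)) * wt W ∂haar) / (∫ W, wt W ∂haar) ≤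
        Cβ * (⨆ W, ‖QA (T W)‖) ^ (-(2 * s)) :=
    (hfib QA hP hQA hPex).2.2 (2 * s) (by linarith) hs2
  rw [← hMAdef] at hNegA
  have hNegD : Integrable (fun W => ‖QD (T W)‖ ^ (-(2 * s)) * wt W) haar ∧
      (∫ W, ‖QD (T W)‖ ^ (-(2 * s)) * wt W ∂haar) / (∫ W, wt W ∂haar) ≤
        Cβ * (⨆ W, ‖QD (T W)‖) ^ (-(2 * s)) :=
    (hfib QD hP hQD hPex).2.2 (2 * s) (by linarith) hs2
  rw [← hMDdef] at hNegD
  -- (AE) for `QD`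
  have hAE : ∀ᵐ W ∂haar, QD (T W) ≠ 0 := by
    obtain ⟨W₁, hW₁⟩ := exists_lt_of_lt_ciSup (f := fun W => ‖QD (T W)‖) (hMDdef ▸ hMDpos)
    exact (hfib QD hP hQD hPex).1 ⟨W₁, norm_pos_iff.1 hW₁⟩
  -- (Flat) for the largest entry
  have hFlat : ∀ W₀, ‖ent κs (T W₀)‖ ≤ Cβ * ((∫ W, ‖ent κs (T W)‖ * wt W ∂haar) / (∫ W, wt W ∂haar)) :=
    (hfib (ent κs) hP (hent κs) hPex).2.1
  -- positive powers of the suprema and the AM–GM parameter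
  obtain ⟨u, hu⟩ : ∃ t : ℝ, t = MA ^ s := ⟨_, rfl⟩
  obtain ⟨v, hv⟩ : ∃ t : ℝ, t = MD ^ s := ⟨_, rfl⟩
  obtain ⟨w, hw⟩ : ∃ t : ℝ, t = (144 * σs) ^ s := ⟨_, rfl⟩
  have hu0 : 0 < u := hu ▸ Real.rpow_pos_of_pos hMApos s
  have hv0 : 0 < v := hv ▸ Real.rpow_pos_of_pos hMDpos s
  have hσ0 : 0 < 144 * σs := by positivity
  have hw0 : 0 < w := hw ▸ Real.rpow_pos_of_pos hσ0 s
  obtain ⟨lam, hlam⟩ : ∃ t : ℝ, t = w * v⁻¹ * u := ⟨_, rfl⟩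
  have hlam0 : 0 < lam := by rw [hlam]; positivity
  have neg2 : ∀ x : ℝ, 0 ≤ x → x ^ (-(2 * s)) = ((x ^ s) ^ 2)⁻¹ := fun x hx => by rw [Real.rpow_neg hx, rpow_sq_eq x s hx]
  have neg1 : ∀ x : ℝ, 0 ≤ x → x ^ (-s) = (x ^ s)⁻¹ := fun x hx => Real.rpow_neg hx s
  have hCM : 0 ≤ (C₀ * MA) ^ s := Real.rpow_nonneg (mul_nonneg hC₀.le hMA0) _
  obtain ⟨k₁, hk₁⟩ : ∃ t : ℝ, t = (C₀ * MA) ^ s / 2 * lam := ⟨_, rfl⟩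
  obtain ⟨k₂, hk₂⟩ : ∃ t : ℝ, t = (C₀ * MA) ^ s / 2 * lam⁻¹ * w ^ 2 := ⟨_, rfl⟩
  have hk₁0 : 0 ≤ k₁ := hk₁ ▸ mul_nonneg (div_nonneg hCM (by norm_num)) hlam0.le
  have hk₂0 : 0 ≤ k₂ :=
    hk₂ ▸ mul_nonneg (mul_nonneg (div_nonneg hCM (by norm_num)) (inv_nonneg.2 hlam0.le)) (sq_nonneg _)
  -- the pointwise bound: Cramer, K1♭, AM–GM
  have hpt : ∀ W, wt W * (X W * Y W) ≤
      k₁ * (‖QA (T W)‖ ^ (-(2 * s)) * wt W) + k₂ * (‖QD (T W)‖ ^ (-(2 * s)) * wt W) := by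
    intro W
    have hqA0 : 0 ≤ ‖QA (T W)‖ := norm_nonneg _
    have hqD0 : 0 ≤ ‖QD (T W)‖ := norm_nonneg _
    have hadj : blockNorm (sideMatrix A (wilsonD (T W) m₀)).adjugate a b ≤ C₀ * MA := by
      rw [hMAdef]; exact hdom W
    have hX : X W ≤ (C₀ * MA) ^ s * ‖QA (T W)‖ ^ (-s) := by
      simp only [hXdef]; rw [gside, blockNorm_inv_rpow]
      exact mul_le_mul_of_nonneg_right (Real.rpow_le_rpow (blockNorm_nonneg _ _ _) hadj hs.le)
        (Real.rpow_nonneg hqA0 _)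
    have hYeq : Y W = blockNorm (wilsonD (T W) m₀).adjugate c d ^ s * ‖QD (T W)‖ ^ (-s) := by
      simp only [hYdef]; rw [blockNorm_inv_rpow]
    have hYle : Y W ≤ w * ‖QD (T W)‖ ^ (-s) := by
      rw [hYeq, hw]
      exact mul_le_mul_of_nonneg_right (Real.rpow_le_rpow (blockNorm_nonneg _ _ _) (hadjD W) hs.le)
        (Real.rpow_nonneg hqD0 _)
    have hY2 : Y W ^ 2 ≤ w ^ 2 * ‖QD (T W)‖ ^ (-(2 * s)) := by
      have h := pow_le_pow_left₀ (hY0 W) hYle 2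
      rwa [mul_pow, rpow_neg_sq_eq _ _ hqD0] at h
    have hamgm := two_mul_mul_le_param (‖QA (T W)‖ ^ (-s)) (Y W) lam hlam0
    rw [rpow_neg_sq_eq _ _ hqA0] at hamgm
    have step1 : X W * Y W ≤ (C₀ * MA) ^ s * (‖QA (T W)‖ ^ (-s) * Y W) := by
      calc X W * Y W ≤ ((C₀ * MA) ^ s * ‖QA (T W)‖ ^ (-s)) * Y W := mul_le_mul_of_nonneg_right hX (hY0 W)
        _ = _ := by ring
    have step2 : ‖QA (T W)‖ ^ (-s) * Y W ≤
        (lam * ‖QA (T W)‖ ^ (-(2 * s)) + lam⁻¹ * (w ^ 2 * ‖QD (T W)‖ ^ (-(2 * s)))) / 2 := by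
      have h3 : lam⁻¹ * Y W ^ 2 ≤ lam⁻¹ * (w ^ 2 * ‖QD (T W)‖ ^ (-(2 * s))) :=
        mul_le_mul_of_nonneg_left hY2 (inv_nonneg.2 hlam0.le)
      linarith
    calc wt W * (X W * Y W) ≤ wt W * ((C₀ * MA) ^ s * (‖QA (T W)‖ ^ (-s) * Y W)) :=
          mul_le_mul_of_nonneg_left step1 (hwt0 W)
      _ ≤ wt W * ((C₀ * MA) ^ s *
          ((lam * ‖QA (T W)‖ ^ (-(2 * s)) + lam⁻¹ * (w ^ 2 * ‖QD (T W)‖ ^ (-(2 * s)))) / 2)) :=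
          mul_le_mul_of_nonneg_left (mul_le_mul_of_nonneg_left step2 hCM) (hwt0 W)
      _ = k₁ * (‖QA (T W)‖ ^ (-(2 * s)) * wt W) + k₂ * (‖QD (T W)‖ ^ (-(2 * s)) * wt W) := by
          rw [hk₁, hk₂]; ring
  -- integrate the pointwise bound and use (Neg) twice
  have hmA : Measurable fun W => ENNReal.ofReal (‖QA (T W)‖ ^ (-(2 * s)) * wt W) :=
    ((hQAc.measurable.pow_const _).mul hwtm).ennreal_ofReal
  have hmD : Measurable fun W => ENNReal.ofReal (‖QD (T W)‖ ^ (-(2 * s)) * wt W) :=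
    ((hQDc.measurable.pow_const _).mul hwtm).ennreal_ofReal
  have hBA0 : 0 ≤ Cβ * MA ^ (-(2 * s)) := mul_nonneg hCβ0 (Real.rpow_nonneg hMA0 _)
  have hBD0 : 0 ≤ Cβ * MD ^ (-(2 * s)) := mul_nonneg hCβ0 (Real.rpow_nonneg hMD0 _)
  have hIA := lintegral_ofReal_mul_le_of_div_le haar hwt0 (fun W => Real.rpow_nonneg (norm_nonneg _) _) hwti
    hNegA.1 hBA0 hNegA.2
  have hID := lintegral_ofReal_mul_le_of_div_le haar hwt0 (fun W => Real.rpow_nonneg (norm_nonneg _) _) hwti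
    hNegD.1 hBD0 hNegD.2
  have hident : k₁ * (Cβ * MA ^ (-(2 * s))) + k₂ * (Cβ * MD ^ (-(2 * s))) = C₀ ^ s * Cβ * (w * v⁻¹) := by
    have hu' : u ≠ 0 := hu0.ne'; have hv' : v ≠ 0 := hv0.ne'; have hw' : w ≠ 0 := hw0.ne'
    rw [hk₁, hk₂, hlam, neg2 MA hMA0, neg2 MD hMD0, Real.mul_rpow hC₀.le hMA0, ← hu, ← hv]
    field_simp; ring
  have hupper : ∫⁻ W, ENNReal.ofReal (wt W * (X W * Y W)) ∂haar ≤
      ENNReal.ofReal (C₀ ^ s * Cβ * (w * v⁻¹)) * ∫⁻ W, ENNReal.ofReal (wt W) ∂haar := by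
    calc ∫⁻ W, ENNReal.ofReal (wt W * (X W * Y W)) ∂haar
        ≤ ∫⁻ W, (ENNReal.ofReal k₁ * ENNReal.ofReal (‖QA (T W)‖ ^ (-(2 * s)) * wt W) +
            ENNReal.ofReal k₂ * ENNReal.ofReal (‖QD (T W)‖ ^ (-(2 * s)) * wt W)) ∂haar := by
          refine lintegral_mono fun W => ?_
          have h1 : 0 ≤ ‖QA (T W)‖ ^ (-(2 * s)) * wt W := mul_nonneg (Real.rpow_nonneg (norm_nonneg _) _) (hwt0 W)
          have h2 : 0 ≤ ‖QD (T W)‖ ^ (-(2 * s)) * wt W := mul_nonneg (Real.rpow_nonneg (norm_nonneg _) _) (hwt0 W)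
          rw [← ENNReal.ofReal_mul hk₁0, ← ENNReal.ofReal_mul hk₂0,
            ← ENNReal.ofReal_add (mul_nonneg hk₁0 h1) (mul_nonneg hk₂0 h2)]
          exact ENNReal.ofReal_le_ofReal (hpt W)
      _ = ENNReal.ofReal k₁ * ∫⁻ W, ENNReal.ofReal (‖QA (T W)‖ ^ (-(2 * s)) * wt W) ∂haar +
            ENNReal.ofReal k₂ * ∫⁻ W, ENNReal.ofReal (‖QD (T W)‖ ^ (-(2 * s)) * wt W) ∂haar := by
          rw [lintegral_add_left (hmA.const_mul _), lintegral_const_mul _ hmA, lintegral_const_mul _ hmD]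
      _ ≤ ENNReal.ofReal k₁ * (ENNReal.ofReal (Cβ * MA ^ (-(2 * s))) * ∫⁻ W, ENNReal.ofReal (wt W) ∂haar) +
            ENNReal.ofReal k₂ * (ENNReal.ofReal (Cβ * MD ^ (-(2 * s))) * ∫⁻ W, ENNReal.ofReal (wt W) ∂haar) := by
          gcongr
      _ = ENNReal.ofReal (C₀ ^ s * Cβ * (w * v⁻¹)) * ∫⁻ W, ENNReal.ofReal (wt W) ∂haar := by
          rw [← hident, ENNReal.ofReal_add (mul_nonneg hk₁0 hBA0) (mul_nonneg hk₂0 hBD0),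
            ENNReal.ofReal_mul hk₁0, ENNReal.ofReal_mul hk₂0]
          ring
  -- the reverse inequality: `σs^s v⁻¹ Z ≤ Cβ ∫ wt Y`
  have hent_int : Integrable (fun W => ‖ent κs (T W)‖ * wt W) haar :=
    hwti.bdd_mul (hentc κs).measurable.aestronglyMeasurable (ae_of_all _ fun W => by
      rw [Real.norm_eq_abs, abs_of_nonneg (norm_nonneg _)]; exact hleσκ κs W)
  have hZ : ENNReal.ofReal (∫ W, wt W ∂haar) = ∫⁻ W, ENNReal.ofReal (wt W) ∂haar :=
    ofReal_integral_eq_lintegral_ofReal hwti (ae_of_all _ hwt0)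
  have hE : ENNReal.ofReal (∫ W, ‖ent κs (T W)‖ * wt W ∂haar) = ∫⁻ W, ENNReal.ofReal (‖ent κs (T W)‖ * wt W) ∂haar :=
    ofReal_integral_eq_lintegral_ofReal hent_int (ae_of_all _ fun W => mul_nonneg (norm_nonneg _) (hwt0 W))
  have hflat' : ENNReal.ofReal σs * ∫⁻ W, ENNReal.ofReal (wt W) ∂haar ≤
      ENNReal.ofReal Cβ * ∫⁻ W, ENNReal.ofReal (‖ent κs (T W)‖ * wt W) ∂haar := by
    have hsup : σs ≤ Cβ * ((∫ W, ‖ent κs (T W)‖ * wt W ∂haar) / (∫ W, wt W ∂haar)) := by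
      rw [hσsdef, hσκdef]
      exact ciSup_le hFlat
    have hreal := mul_integral_le_of_le_div haar hwt0 hCβ0
      (integral_nonneg fun W => mul_nonneg (norm_nonneg _) (hwt0 W)) hsup
    rw [← hZ, ← hE, ← ENNReal.ofReal_mul hσs0, ← ENNReal.ofReal_mul hCβ0]
    exact ENNReal.ofReal_le_ofReal hreal
  have hlowpt : ∀ᵐ W ∂haar, ENNReal.ofReal ((σs ^ (s - 1) * v⁻¹) * (‖ent κs (T W)‖ * wt W)) ≤
      ENNReal.ofReal (wt W * Y W) := by
    filter_upwards [hAE] with W hW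
    refine ENNReal.ofReal_le_ofReal ?_
    have hqDpos : 0 < ‖QD (T W)‖ := norm_pos_iff.2 hW
    have h1 : v⁻¹ ≤ ‖QD (T W)‖ ^ (-s) := by
      rw [hv, ← neg1 MD hMD0]
      exact Real.rpow_le_rpow_of_nonpos hqDpos (hleMD W) (by linarith)
    have h2 : σs ^ (s - 1) * ‖ent κs (T W)‖ ≤ blockNorm (wilsonD (T W) m₀).adjugate c d ^ s :=
      (rpow_sub_one_mul_le_rpow _ _ s hs hs1 (norm_nonneg _) (hσsdef ▸ hleσκ κs W)).trans
        (Real.rpow_le_rpow (norm_nonneg _) (norm_apply_le_blockNorm _ c d _ _ _ _) hs.le)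
    have hYeq : Y W = blockNorm (wilsonD (T W) m₀).adjugate c d ^ s * ‖QD (T W)‖ ^ (-s) := by
      simp only [hYdef]; rw [blockNorm_inv_rpow]
    rw [hYeq]
    have h3 : σs ^ (s - 1) * ‖ent κs (T W)‖ * v⁻¹ ≤
        blockNorm (wilsonD (T W) m₀).adjugate c d ^ s * ‖QD (T W)‖ ^ (-s) :=
      mul_le_mul h2 h1 (inv_nonneg.2 hv0.le) (Real.rpow_nonneg (blockNorm_nonneg _ _ _) _)
    calc σs ^ (s - 1) * v⁻¹ * (‖ent κs (T W)‖ * wt W) = (σs ^ (s - 1) * ‖ent κs (T W)‖ * v⁻¹) * wt W := by ring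
      _ ≤ (blockNorm (wilsonD (T W) m₀).adjugate c d ^ s * ‖QD (T W)‖ ^ (-s)) * wt W :=
          mul_le_mul_of_nonneg_right h3 (hwt0 W)
      _ = _ := by ring
  have hme : Measurable fun W => ENNReal.ofReal (‖ent κs (T W)‖ * wt W) :=
    ((hentc κs).measurable.mul hwtm).ennreal_ofReal
  have hsv0 : 0 ≤ σs ^ (s - 1) * v⁻¹ := mul_nonneg (Real.rpow_nonneg hσs0 _) (inv_nonneg.2 hv0.le)
  have hlower : ENNReal.ofReal (σs ^ s * v⁻¹) * ∫⁻ W, ENNReal.ofReal (wt W) ∂haar ≤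
      ENNReal.ofReal Cβ * ∫⁻ W, ENNReal.ofReal (wt W * Y W) ∂haar := by
    have hsplit : σs ^ s * v⁻¹ = (σs ^ (s - 1) * v⁻¹) * σs := by
      rw [Real.rpow_sub_one hσspos.ne']
      field_simp
    calc ENNReal.ofReal (σs ^ s * v⁻¹) * ∫⁻ W, ENNReal.ofReal (wt W) ∂haar
        = ENNReal.ofReal (σs ^ (s - 1) * v⁻¹) * (ENNReal.ofReal σs * ∫⁻ W, ENNReal.ofReal (wt W) ∂haar) := by
          rw [hsplit, ENNReal.ofReal_mul hsv0, mul_assoc]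
      _ ≤ ENNReal.ofReal (σs ^ (s - 1) * v⁻¹) *
          (ENNReal.ofReal Cβ * ∫⁻ W, ENNReal.ofReal (‖ent κs (T W)‖ * wt W) ∂haar) := by gcongr
      _ = ENNReal.ofReal Cβ * (ENNReal.ofReal (σs ^ (s - 1) * v⁻¹) *
          ∫⁻ W, ENNReal.ofReal (‖ent κs (T W)‖ * wt W) ∂haar) := by ring
      _ = ENNReal.ofReal Cβ * ∫⁻ W, ENNReal.ofReal ((σs ^ (s - 1) * v⁻¹) * (‖ent κs (T W)‖ * wt W)) ∂haar := by
          congr 1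
          rw [← lintegral_const_mul _ hme]
          refine lintegral_congr fun W => ?_
          rw [ENNReal.ofReal_mul hsv0]
      _ ≤ ENNReal.ofReal Cβ * ∫⁻ W, ENNReal.ofReal (wt W * Y W) ∂haar := by
          gcongr ENNReal.ofReal Cβ * ?_
          exact lintegral_mono_ae hlowpt
  -- assemble
  have h144 : w * v⁻¹ = (144 : ℝ) ^ s * (σs ^ s * v⁻¹) := by
    rw [hw, Real.mul_rpow (by norm_num) hσs0]; ring
  have hc1 : 0 ≤ C₀ ^ s * Cβ := mul_nonneg (Real.rpow_nonneg hC₀.le _) hCβ0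
  have hc2 : 0 ≤ (144 : ℝ) ^ s := Real.rpow_nonneg (by norm_num) _
  have hc3 : 0 ≤ σs ^ s * v⁻¹ := mul_nonneg (Real.rpow_nonneg hσs0 _) (inv_nonneg.2 hv0.le)
  calc ∫⁻ W, ENNReal.ofReal (wt W * (X W * Y W)) ∂haar
      ≤ ENNReal.ofReal (C₀ ^ s * Cβ * (w * v⁻¹)) * ∫⁻ W, ENNReal.ofReal (wt W) ∂haar := hupper
    _ = ENNReal.ofReal (C₀ ^ s * Cβ) * ENNReal.ofReal ((144 : ℝ) ^ s) *
          (ENNReal.ofReal (σs ^ s * v⁻¹) * ∫⁻ W, ENNReal.ofReal (wt W) ∂haar) := by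
        rw [h144, ENNReal.ofReal_mul hc1, ENNReal.ofReal_mul hc2]; ring
    _ ≤ ENNReal.ofReal (C₀ ^ s * Cβ) * ENNReal.ofReal ((144 : ℝ) ^ s) *
          (ENNReal.ofReal Cβ * ∫⁻ W, ENNReal.ofReal (wt W * Y W) ∂haar) := by gcongr
    _ = ENNReal.ofReal (C₀ ^ s * (144 : ℝ) ^ s * Cβ ^ 2) * ∫⁻ W, ENNReal.ofReal (wt W * Y W) ∂haar := by
        rw [← ENNReal.ofReal_mul hc1, ← mul_assoc, ← ENNReal.ofReal_mul (mul_nonneg hc1 hc2)]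
        congr 2
        ring


end Generic

/-- **Registered helper `stub_twoStarOfPadded_aux2` of crux stmt-QuantumFields-17375** (line `pad-the-fibre`, stub
`stub_twoStarOfPadded`): the fibre form of clause (Tdec) from the fibre band law at `n` links and the domination of the
ONE fibre at hand (no K1♭, no admissibility). [cite: AizenmanEtAl2001, Lemma 6] -/
theorem stub_twoStarOfPadded_aux2 : ∀ (n Nf : ℕ) (C₀ : ℝ), 0 < C₀ → FibreBandLaw → ∃ s₁ K p : ℝ, 0 < s₁ ∧ 0 < K ∧ ∀ (S : ℕ) (β m₀ : ℝ) (mq : Fin Nf → ℝ) (A : Finset (TorusSite 4 (2 * S + 1))) (a b c d : TorusSite 4 (2 * S + 1)) (R : Finset (Edge 4 (2 * S + 1))), R.card ≤ n → ∀ (s : ℝ), 0 < s → s ≤ s₁ → ∀ (U : GaugeConfig 4 (2 * S + 1) (Matrix.specialUnitaryGroup (Fin 3) ℂ)), (∀ W : GaugeConfig 4 (2 * S + 1) (Matrix.specialUnitaryGroup (Fin 3) ℂ), blockNorm ((sideMatrix A (wilsonD (fun e => if e ∈ R then W e else U e) m₀)).adjugate) a b ≤ C₀ * ⨆ W' : GaugeConfig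 4 (2 * S + 1) (Matrix.specialUnitaryGroup (Fin 3) ℂ), ‖(sideMatrix A (wilsonD (fun e => if e ∈ R then W' e else U e) m₀)).det‖) → ∫⁻ W, ENNReal.ofReal (Real.exp (-(β * wilsonAction (fundamentalRep (Fin 3)) (fun e => if e ∈ R then W e else U e))) * ‖(diracMatrix (fun e => if e ∈ R then W e else U e) mq).det‖ * (blockNorm (gside A (wilsonD (fun e => if e ∈ R then W e else U e) m₀)) a b ^ s * blockNorm (wilsonD (fun e => if e ∈ R then W e else U e) m₀)⁻¹ c d ^ s)) ∂(Measure.pi fun _ : Edge 4 (2 * S + 1) => haarProbability (Matrix.specialUnitaryGroup (Fin 3) ℂ)) ≤ ENNReal.ofReal (K ^ s * (K * (1 + |β|) ^ p) ^ 2) * ∫⁻ W, ENNReal.ofReal (Real.exp (-(β * wilsonAction (fundamentalRep (Fin 3)) (fun e => if e ∈ R then W e else U e))) * ‖(diracMatrix (fun e => if e ∈ R then W e else U e) mq).det‖ * blockNorm (wilsonD (fun e => if e ∈ R then W e else U e) m₀)⁻¹ c d ^ s) ∂(Measure.pi fun _ : Edge 4 (2 * S + 1) => haarProbability (Matrix.specialUnitaryGroup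 (Fin 3) ℂ)) := by
  intro n Nf C₀ hC₀ hFBL
  obtain ⟨sB, C₁, p₁, hsB, hC₁, hB⟩ := hFBL n (4 * Nf + 4)
  refine ⟨min (sB / 2) 1, max (144 * C₀) C₁, p₁, lt_min (by linarith) one_pos,
    lt_max_of_lt_left (by positivity), ?_⟩
  intro S β m₀ mq A a b c d R hRcard s hs hsle U hdom
  have hs1 : s ≤ 1 := hsle.trans (min_le_right _ _)
  have hs2 : 2 * s ≤ sB := by have := hsle.trans (min_le_left _ _); linarith
  refine (fibre_Tdec_of_dom (m₀ := m₀) hB hC₁ hC₀ β mq A a b c d R hRcard s hs hs1 hs2 U hdom).trans ?_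
  refine mul_le_mul_of_nonneg_right (ENNReal.ofReal_le_ofReal ?_) bot_le
  have hB0 : 0 ≤ (1 + |β|) ^ p₁ := Real.rpow_nonneg (by positivity) _
  have h1 : C₀ ^ s * (144 : ℝ) ^ s ≤ max (144 * C₀) C₁ ^ s := by
    rw [← Real.mul_rpow hC₀.le (by norm_num), mul_comm]
    exact Real.rpow_le_rpow (by positivity) (le_max_left _ _) hs.le
  have h2 : (C₁ * (1 + |β|) ^ p₁) ^ 2 ≤ (max (144 * C₀) C₁ * (1 + |β|) ^ p₁) ^ 2 :=
    pow_le_pow_left₀ (mul_nonneg hC₁.le hB0) (mul_le_mul_of_nonneg_right (le_max_right _ _) hB0) 2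
  exact mul_le_mul h1 h2 (sq_nonneg _) (Real.rpow_nonneg (le_trans (by positivity) (le_max_left _ _)) _)

end Summit.QuantumFields.QCD.Theorems.PadTheFibreTwoStar
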